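import Summits.Schanuel.Schanuel.Theorems.SoloInformedMixedClassBudget
import Summits.Schanuel.Schanuel.Theorems.SoloInformedClusterBudget

/-!
# The mixed cluster budget (multiplicity-weighted selection)

Solo-informed Schanuel seat, session s191 (2026-08-31); fifth file (K4b) of the seat's kernel
plan for the MIXED Lemma AE₃ (`work/s188/MIXED-AE3-note.md` §2 (e)–(f), §6).

This is `soloCB_cluster_budget` (`SoloInformedClusterBudget`) run on the DISTINCT complex roots
`ρ : Fin D → ℂ` (injective) of `Q ≠ 0` with selection weights `w = m · u`, `m i` the
multiplicity of `ρ i` in `Q`, `u` the cluster weights (`‖ρ i − xξ‖ ≤ e^{−u}`, `u ≥ θ ≥ 2 log 4`,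
`0 < U' ≤ ∑_{Cl x} m u`).  For a violated non-degenerate configuration with roots
`(ρ i, ρ j, ρ k)` at the progression `(x, m, z)`,
`U' · p p' p'' ≤ min (m_i u_i, m_j u_j, m_k u_k) ≤ m_ŝ · min u ≤ 2 m_ŝ log (1/‖ρ i + ρ k − 2ρ j‖)`
with `ŝ` the slot of least `u` (`soloMB_term_le`); the pairs are then sorted by `ŝ` and by the
dyadic class `2^j ≤ m_ŝ < 2^(j+1)` (`j ≤ log₂ deg Q`), and each class is charged by
`SoloInformedMixedClassBudget` (`2^j ∑ log(1/‖·‖) ≤ B'`,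
`B' = (deg F)² log M(Q) + 2 deg Q deg F log M(F) + deg Q (deg F)² log 4`, `F ≠ 0` any integer
polynomial vanishing at all roots of `Q`) — `soloMB_slot_sum_le`.  Result
(`soloMB_mixed_budget`):

  `U' · ∑_{(x,m,z)} ∑_{violating (i,j,k)} p p' p'' ≤ 12 (log₂ deg Q + 1) · B'`.

With `F` the radical of `Q` (`deg F ≤ D_F`, `log M(F) ≤ L_F`) this replaces the one-polynomial
budget `3 N² L + N³ log 4` of the seat's AE₃♯ by one quadratic in `D_F`, which is what the
mixed Lemma AE₃ (next file) feeds on.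

## Why (seat bookkeeping)

Toy layer only (node `RoyAdditiveDirichletExponent`, [cite: Roy2010, Thm 1.1]); nothing here
bears on `Literature.Periods.SchanuelConjecture`; the seat's verdict (no path) is unchanged.
No novelty claimed; Mathlib + the seat files only; no definitions; no literature hypotheses;
standard axioms.
-/

namespace Summit.Schanuel.Schanuel.Theorems

open Finset Polynomial

section Slot

variable {D : ℕ}

/-- **Dyadic summation over one slot.**  If every class `e ≥ 1` of index triples (drawn from
the disjoint family `G c`, `c ∈ A`) whose slot-`π` multiplicity is `≥ e` satisfies
`e ∑ ℓ ≤ B`, then `∑_c ∑_{G c} m_π ℓ ≤ 2 (log₂ N_Q + 1) B` (`1 ≤ m ≤ N_Q`, `ℓ ≥ 0`). -/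
theorem soloMB_slot_sum_le {NQ : ℕ} (m : Fin D → ℕ) (hm1 : ∀ k, 1 ≤ m k)
    (hmN : ∀ k, m k ≤ NQ) (π : Fin D × Fin D × Fin D → Fin D)
    (ℓ : Fin D × Fin D × Fin D → ℝ) (A : Finset (ℕ × ℕ × ℕ))
    (G : ℕ × ℕ × ℕ → Finset (Fin D × Fin D × Fin D))
    (hdisj : (A : Set (ℕ × ℕ × ℕ)).PairwiseDisjoint G) (hℓ : ∀ c ∈ A, ∀ q ∈ G c, 0 ≤ ℓ q)
    {B : ℝ} (hclass : ∀ e : ℕ, 1 ≤ e → ∀ T : Finset (Fin D × Fin D × Fin D),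
      (∀ q ∈ T, ∃ c ∈ A, q ∈ G c) → (∀ q ∈ T, e ≤ m (π q)) → (e : ℝ) * ∑ q ∈ T, ℓ q ≤ B) :
    ∑ c ∈ A, ∑ q ∈ G c, (m (π q) : ℝ) * ℓ q ≤ 2 * (Nat.log 2 NQ + 1) * B := by
  classical
  set J := Nat.log 2 NQ with hJ
  set cls : Fin D × Fin D × Fin D → ℕ := fun q => Nat.log 2 (m (π q)) with hcls
  have hclsJ : ∀ q, cls q ∈ Finset.range (J + 1) :=
    fun q => Finset.mem_range.mpr (Nat.lt_succ_of_le (Nat.log_mono_right (hmN _)))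
  have hfib : ∀ c, ∑ q ∈ G c, (m (π q) : ℝ) * ℓ q =
      ∑ j ∈ range (J + 1), ∑ q ∈ (G c).filter (fun q => cls q = j), (m (π q) : ℝ) * ℓ q :=
    fun c => (Finset.sum_fiberwise_of_maps_to (fun q _ => hclsJ q) _).symm
  rw [Finset.sum_congr rfl (fun c _ => hfib c), Finset.sum_comm]
  have hj : ∀ j ∈ range (J + 1),
      ∑ c ∈ A, ∑ q ∈ (G c).filter (fun q => cls q = j), (m (π q) : ℝ) * ℓ q ≤ 2 * B := by
    intro j _
    set Gj : ℕ × ℕ × ℕ → Finset (Fin D × Fin D × Fin D) :=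
      fun c => (G c).filter (fun q => cls q = j) with hGj
    have hdisj' : (A : Set (ℕ × ℕ × ℕ)).PairwiseDisjoint Gj :=
      hdisj.mono (fun c => Finset.filter_subset _ _)
    have hbound : ∀ c ∈ A, ∀ q ∈ Gj c, (m (π q) : ℝ) * ℓ q ≤ 2 * 2 ^ j * ℓ q := by
      intro c hc q hq
      obtain ⟨hqG, hqj⟩ := Finset.mem_filter.mp hq
      refine mul_le_mul_of_nonneg_right ?_ (hℓ c hc q hqG)
      have hlt : m (π q) < 2 ^ (j + 1) := by
        rw [← hqj]
        exact Nat.lt_pow_succ_log_self one_lt_two _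
      calc (m (π q) : ℝ) ≤ ((2 ^ (j + 1) : ℕ) : ℝ) := by exact_mod_cast hlt.le
        _ = 2 * 2 ^ j := by push_cast; ring
    have hT1 : ∀ q ∈ A.biUnion Gj, ∃ c ∈ A, q ∈ G c := by
      intro q hq
      obtain ⟨c, hc, hqc⟩ := Finset.mem_biUnion.mp hq
      exact ⟨c, hc, (Finset.mem_filter.mp hqc).1⟩
    have hT2 : ∀ q ∈ A.biUnion Gj, 2 ^ j ≤ m (π q) := by
      intro q hq
      obtain ⟨c, -, hqc⟩ := Finset.mem_biUnion.mp hq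
      rw [← (Finset.mem_filter.mp hqc).2]
      exact Nat.pow_log_le_self 2 (Nat.one_le_iff_ne_zero.mp (hm1 _))
    have hcl := hclass (2 ^ j) Nat.one_le_two_pow (A.biUnion Gj) hT1 hT2
    push_cast at hcl
    calc ∑ c ∈ A, ∑ q ∈ Gj c, (m (π q) : ℝ) * ℓ q
        ≤ ∑ c ∈ A, ∑ q ∈ Gj c, 2 * 2 ^ j * ℓ q :=
          Finset.sum_le_sum fun c hc => Finset.sum_le_sum fun q hq => hbound c hc q hq
      _ = 2 * (2 ^ j * ∑ q ∈ A.biUnion Gj, ℓ q) := by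
          rw [Finset.sum_biUnion hdisj', Finset.mul_sum, Finset.mul_sum]
          refine Finset.sum_congr rfl (fun c _ => ?_)
          rw [Finset.mul_sum, Finset.mul_sum]
          exact Finset.sum_congr rfl (fun q _ => by ring)
      _ ≤ 2 * B := by linarith
  calc ∑ j ∈ range (J + 1), ∑ c ∈ A, ∑ q ∈ (G c).filter (fun q => cls q = j),
          (m (π q) : ℝ) * ℓ q
      ≤ ∑ _j ∈ range (J + 1), 2 * B := Finset.sum_le_sum hj
    _ = 2 * (Nat.log 2 NQ + 1) * B := by
        rw [Finset.sum_const, Finset.card_range, nsmul_eq_mul]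
        push_cast
        ring

end Slot

section Term

/-- **One configuration.**  `U' p p' p'' ≤ min (m u)` and the slot `ŝ` of least `u` give
`U' p p' p'' ≤ 2 m_ŝ log(1/‖a + c − 2b‖)` (weights `u ≥ θ ≥ 2 log 4`), written with indicator
terms for the three possible slots. -/
theorem soloMB_term_le {a b c x y z : ℂ} {u₁ u₂ u₃ θ U' P : ℝ} {m₁ m₂ m₃ : ℕ}
    (ha : ‖a - x‖ ≤ Real.exp (-u₁)) (hb : ‖b - y‖ ≤ Real.exp (-u₂))
    (hc : ‖c - z‖ ≤ Real.exp (-u₃)) (hxyz : x + z = 2 * y) (hne : a + c - 2 * b ≠ 0)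
    (hθ4 : 2 * Real.log 4 ≤ θ) (h₁ : θ ≤ u₁) (h₂ : θ ≤ u₂) (h₃ : θ ≤ u₃)
    (hP : U' * P ≤ min (m₁ * u₁) (min (m₂ * u₂) (m₃ * u₃)))
    (S₁ S₂ S₃ : Prop) [Decidable S₁] [Decidable S₂] [Decidable S₃]
    (hS₁ : S₁ ↔ (u₁ ≤ u₂ ∧ u₁ ≤ u₃)) (hS₂ : S₂ ↔ (¬ (u₁ ≤ u₂ ∧ u₁ ≤ u₃) ∧ u₂ ≤ u₃))
    (hS₃ : S₃ ↔ (¬ (u₁ ≤ u₂ ∧ u₁ ≤ u₃) ∧ ¬ u₂ ≤ u₃)) :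
    U' * P ≤ 2 * ((if S₁ then (m₁ : ℝ) * Real.log (1 / ‖a + c - 2 * b‖) else 0)
      + (if S₂ then (m₂ : ℝ) * Real.log (1 / ‖a + c - 2 * b‖) else 0)
      + (if S₃ then (m₃ : ℝ) * Real.log (1 / ‖a + c - 2 * b‖) else 0)) := by
  have hmin := soloCW_min_le_log ha hb hc hxyz hne
  set ℓ := Real.log (1 / ‖a + c - 2 * b‖) with hℓ
  have hθmin : θ ≤ min u₁ (min u₂ u₃) := le_min h₁ (le_min h₂ h₃)
  have hM2 : min u₁ (min u₂ u₃) ≤ 2 * ℓ := by linarith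
  have hm₁ : (0 : ℝ) ≤ m₁ := Nat.cast_nonneg _
  have hm₂ : (0 : ℝ) ≤ m₂ := Nat.cast_nonneg _
  have hm₃ : (0 : ℝ) ≤ m₃ := Nat.cast_nonneg _
  by_cases h1 : u₁ ≤ u₂ ∧ u₁ ≤ u₃
  · have hu : u₁ ≤ 2 * ℓ := (le_min le_rfl (le_min h1.1 h1.2)).trans hM2
    rw [if_pos (hS₁.mpr h1), if_neg (fun h => (hS₂.mp h).1 h1),
      if_neg (fun h => (hS₃.mp h).1 h1), add_zero, add_zero]
    calc U' * P ≤ (m₁ : ℝ) * u₁ := hP.trans (min_le_left _ _)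
      _ ≤ m₁ * (2 * ℓ) := mul_le_mul_of_nonneg_left hu hm₁
      _ = 2 * (m₁ * ℓ) := by ring
  · by_cases h2 : u₂ ≤ u₃
    · have hu21 : u₂ ≤ u₁ := by
        by_contra h
        exact h1 ⟨(not_le.mp h).le, (not_le.mp h).le.trans h2⟩
      have hu : u₂ ≤ 2 * ℓ := (le_min hu21 (le_min le_rfl h2)).trans hM2
      rw [if_neg (fun h => h1 (hS₁.mp h)), if_pos (hS₂.mpr ⟨h1, h2⟩),
        if_neg (fun h => (hS₃.mp h).2 h2), zero_add, add_zero]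
      calc U' * P ≤ (m₂ : ℝ) * u₂ := hP.trans ((min_le_right _ _).trans (min_le_left _ _))
        _ ≤ m₂ * (2 * ℓ) := mul_le_mul_of_nonneg_left hu hm₂
        _ = 2 * (m₂ * ℓ) := by ring
    · have hu32 : u₃ ≤ u₂ := (not_le.mp h2).le
      have hu31 : u₃ ≤ u₁ := by
        by_contra h
        exact h1 ⟨((not_le.mp h).trans (not_le.mp h2)).le, (not_le.mp h).le⟩
      have hu : u₃ ≤ 2 * ℓ := (le_min hu31 (le_min hu32 le_rfl)).trans hM2
      rw [if_neg (fun h => h1 (hS₁.mp h)), if_neg (fun h => h2 (hS₂.mp h).2),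
        if_pos (hS₃.mpr ⟨h1, h2⟩), zero_add, zero_add]
      calc U' * P ≤ (m₃ : ℝ) * u₃ :=
            hP.trans ((min_le_right _ _).trans (min_le_right _ _))
        _ ≤ m₃ * (2 * ℓ) := mul_le_mul_of_nonneg_left hu hm₃
        _ = 2 * (m₃ * ℓ) := by ring

end Term

section Budget

variable {D : ℕ}

/-- **The mixed cluster budget.**  See the file header. -/
theorem soloMB_mixed_budget (Q F : ℤ[X]) (hQ : Q ≠ 0) (hF : F ≠ 0) (ρ : Fin D → ℂ)
    (hρ : Function.Injective ρ) (hρF : ∀ k, aeval (ρ k) F = 0) (m : Fin D → ℕ)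
    (hm : ∀ k, m k = rootMultiplicity (ρ k) (Q.map (Int.castRingHom ℂ)))
    (hm1 : ∀ k, 1 ≤ m k) (hmN : ∀ k, m k ≤ Q.natDegree) (ξ : ℂ) {r : ℝ} (hr : r ≤ ‖ξ‖ / 2)
    (S : Finset ℕ) (Cl : ℕ → Finset (Fin D)) (hCl : ∀ x ∈ S, ∀ i ∈ Cl x, ‖ρ i - x * ξ‖ < r)
    (u : ℕ → Fin D → ℝ) (hu : ∀ x ∈ S, ∀ i ∈ Cl x, ‖ρ i - x * ξ‖ ≤ Real.exp (-u x i))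
    {θ : ℝ} (hθ4 : 2 * Real.log 4 ≤ θ) (hθ : ∀ x ∈ S, ∀ i ∈ Cl x, θ ≤ u x i)
    (w : ℕ → Fin D → ℝ) (hw : ∀ x i, w x i = m i * u x i) {U' : ℝ} (hU'0 : 0 < U')
    (hU' : ∀ x ∈ S, U' ≤ ∑ i ∈ Cl x, w x i) :
    U' * ∑ c ∈ (S ×ˢ (S ×ˢ S)).filter (fun c => c.1 + c.2.2 = 2 * c.2.1 ∧ c.1 ≠ c.2.2),
        ∑ q ∈ (Cl c.1 ×ˢ (Cl c.2.1 ×ˢ Cl c.2.2)).filter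
          (· ∈ univ.filter (fun q : Fin D × Fin D × Fin D => ρ q.1 + ρ q.2.2 - 2 * ρ q.2.1 ≠ 0)),
          w c.1 q.1 / (∑ i ∈ Cl c.1, w c.1 i) * (w c.2.1 q.2.1 / ∑ i ∈ Cl c.2.1, w c.2.1 i)
            * (w c.2.2 q.2.2 / ∑ i ∈ Cl c.2.2, w c.2.2 i) ≤
      12 * (Nat.log 2 Q.natDegree + 1) *
        ((F.natDegree : ℝ) ^ 2 * Real.log (Q.map (Int.castRingHom ℂ)).mahlerMeasure
          + 2 * Q.natDegree * F.natDegree * Real.log (F.map (Int.castRingHom ℂ)).mahlerMeasure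
          + Q.natDegree * (F.natDegree : ℝ) ^ 2 * Real.log 4) := by
  classical
  set A : Finset (ℕ × ℕ × ℕ) := (S ×ˢ (S ×ˢ S)).filter
    (fun c => c.1 + c.2.2 = 2 * c.2.1 ∧ c.1 ≠ c.2.2) with hA
  set Bad : Finset (Fin D × Fin D × Fin D) :=
    univ.filter (fun q : Fin D × Fin D × Fin D => ρ q.1 + ρ q.2.2 - 2 * ρ q.2.1 ≠ 0) with hBad
  set L : Fin D × Fin D × Fin D → ℂ := fun q => ρ q.1 + ρ q.2.2 - 2 * ρ q.2.1 with hL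
  set ℓ : Fin D × Fin D × Fin D → ℝ := fun q => Real.log (1 / ‖L q‖) with hℓ
  set Fc : ℕ × ℕ × ℕ → Finset (Fin D × Fin D × Fin D) :=
    fun c => (Cl c.1 ×ˢ (Cl c.2.1 ×ˢ Cl c.2.2)).filter (· ∈ Bad) with hFc
  set B : ℝ := (F.natDegree : ℝ) ^ 2 * Real.log (Q.map (Int.castRingHom ℂ)).mahlerMeasure
    + 2 * Q.natDegree * F.natDegree * Real.log (F.map (Int.castRingHom ℂ)).mahlerMeasure
    + Q.natDegree * (F.natDegree : ℝ) ^ 2 * Real.log 4 with hB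
  -- the three slot predicates
  set P₁ : ℕ × ℕ × ℕ → Fin D × Fin D × Fin D → Prop :=
    fun c q => u c.1 q.1 ≤ u c.2.1 q.2.1 ∧ u c.1 q.1 ≤ u c.2.2 q.2.2 with hP₁
  set P₂ : ℕ × ℕ × ℕ → Fin D × Fin D × Fin D → Prop :=
    fun c q => ¬ P₁ c q ∧ u c.2.1 q.2.1 ≤ u c.2.2 q.2.2 with hP₂
  set P₃ : ℕ × ℕ × ℕ → Fin D × Fin D × Fin D → Prop :=
    fun c q => ¬ P₁ c q ∧ ¬ u c.2.1 q.2.1 ≤ u c.2.2 q.2.2 with hP₃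
  have hlog4 : 0 < Real.log 4 := Real.log_pos (by norm_num)
  have hupos : ∀ x ∈ S, ∀ i ∈ Cl x, 0 < u x i :=
    fun x hx i hi => by linarith [hθ x hx i hi]
  have hwpos : ∀ x ∈ S, ∀ i ∈ Cl x, 0 < w x i := by
    intro x hx i hi
    rw [hw]
    exact mul_pos (Nat.cast_pos.mpr (hm1 i)) (hupos x hx i hi)
  have hAmem : ∀ c ∈ A, (c.1 ∈ S ∧ c.2.1 ∈ S ∧ c.2.2 ∈ S) ∧
      ((c.1 : ℂ) * ξ + (c.2.2 : ℂ) * ξ = 2 * ((c.2.1 : ℂ) * ξ)) := by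
    intro c hc
    rw [hA, Finset.mem_filter, Finset.mem_product, Finset.mem_product] at hc
    refine ⟨hc.1, ?_⟩
    have h : (c.1 : ℂ) + c.2.2 = 2 * c.2.1 := by exact_mod_cast hc.2.1
    rw [← add_mul, h, mul_assoc]
  have hFmem : ∀ c q, q ∈ Fc c → (q.1 ∈ Cl c.1 ∧ q.2.1 ∈ Cl c.2.1 ∧ q.2.2 ∈ Cl c.2.2) ∧
      L q ≠ 0 := by
    intro c q hq
    rw [hFc, Finset.mem_filter, Finset.mem_product, Finset.mem_product, hBad,
      Finset.mem_filter] at hq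
    exact ⟨hq.1, hq.2.2⟩
  -- Step 1: term by term
  have hterm : ∀ c ∈ A, ∀ q ∈ Fc c,
      U' * (w c.1 q.1 / (∑ i ∈ Cl c.1, w c.1 i) * (w c.2.1 q.2.1 / ∑ i ∈ Cl c.2.1, w c.2.1 i)
        * (w c.2.2 q.2.2 / ∑ i ∈ Cl c.2.2, w c.2.2 i)) ≤
      2 * ((if P₁ c q then (m q.1 : ℝ) * ℓ q else 0)
        + (if P₂ c q then (m q.2.1 : ℝ) * ℓ q else 0)
        + (if P₃ c q then (m q.2.2 : ℝ) * ℓ q else 0)) := by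
    intro c hc q hq
    obtain ⟨⟨hx, hy, hz⟩, hxyz⟩ := hAmem c hc
    obtain ⟨⟨hi, hj, hk⟩, hLq⟩ := hFmem c q hq
    have hppp := soloCB_prod_le_min_div hU'0.le
      (div_nonneg (hwpos _ hx _ hi).le (Finset.sum_nonneg fun i h => (hwpos _ hx i h).le))
      (div_nonneg (hwpos _ hy _ hj).le (Finset.sum_nonneg fun i h => (hwpos _ hy i h).le))
      (div_nonneg (hwpos _ hz _ hk).le (Finset.sum_nonneg fun i h => (hwpos _ hz i h).le))
      (soloCB_div_sum_le_one _ _ (hwpos _ hx) hi) (soloCB_div_sum_le_one _ _ (hwpos _ hy) hj)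
      (soloCB_div_sum_le_one _ _ (hwpos _ hz) hk)
      (soloCB_div_sum_le_div _ _ (hwpos _ hx) hU'0 (hU' _ hx) hi)
      (soloCB_div_sum_le_div _ _ (hwpos _ hy) hU'0 (hU' _ hy) hj)
      (soloCB_div_sum_le_div _ _ (hwpos _ hz) hU'0 (hU' _ hz) hk)
    have hP : U' * (w c.1 q.1 / (∑ i ∈ Cl c.1, w c.1 i)
        * (w c.2.1 q.2.1 / ∑ i ∈ Cl c.2.1, w c.2.1 i)
        * (w c.2.2 q.2.2 / ∑ i ∈ Cl c.2.2, w c.2.2 i)) ≤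
        min ((m q.1 : ℝ) * u c.1 q.1)
          (min ((m q.2.1 : ℝ) * u c.2.1 q.2.1) ((m q.2.2 : ℝ) * u c.2.2 q.2.2)) := by
      rw [← hw, ← hw, ← hw]
      calc U' * (w c.1 q.1 / (∑ i ∈ Cl c.1, w c.1 i)
            * (w c.2.1 q.2.1 / ∑ i ∈ Cl c.2.1, w c.2.1 i)
            * (w c.2.2 q.2.2 / ∑ i ∈ Cl c.2.2, w c.2.2 i))
          ≤ U' * (min (w c.1 q.1) (min (w c.2.1 q.2.1) (w c.2.2 q.2.2)) / U') :=
            mul_le_mul_of_nonneg_left hppp hU'0.le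
        _ = min (w c.1 q.1) (min (w c.2.1 q.2.1) (w c.2.2 q.2.2)) := by field_simp
    exact soloMB_term_le (hu _ hx _ hi) (hu _ hy _ hj) (hu _ hz _ hk) hxyz hLq hθ4
      (hθ _ hx _ hi) (hθ _ hy _ hj) (hθ _ hz _ hk) hP (P₁ c q) (P₂ c q) (P₃ c q) Iff.rfl
      Iff.rfl Iff.rfl
  -- Step 2: the sets `Fc c`, `c ∈ A`, are pairwise disjoint (disjoint clusters)
  have hdisj : (A : Set (ℕ × ℕ × ℕ)).PairwiseDisjoint Fc := by
    intro c hc c' hc' hne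
    rw [Function.onFun, Finset.disjoint_left]
    intro q hq hq'
    obtain ⟨⟨hx, hy, hz⟩, -⟩ := hAmem c hc
    obtain ⟨⟨hx', hy', hz'⟩, -⟩ := hAmem c' hc'
    obtain ⟨⟨hi, hj, hk⟩, -⟩ := hFmem c q hq
    obtain ⟨⟨hi', hj', hk'⟩, -⟩ := hFmem c' q hq'
    have e1 : c.1 = c'.1 := soloCB_point_eq ρ ξ ((hCl _ hx _ hi).trans_le hr)
      ((hCl _ hx' _ hi').trans_le hr)
    have e2 : c.2.1 = c'.2.1 := soloCB_point_eq ρ ξ ((hCl _ hy _ hj).trans_le hr)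
      ((hCl _ hy' _ hj').trans_le hr)
    have e3 : c.2.2 = c'.2.2 := soloCB_point_eq ρ ξ ((hCl _ hz _ hk).trans_le hr)
      ((hCl _ hz' _ hk').trans_le hr)
    exact hne (Prod.ext e1 (Prod.ext e2 e3))
  -- Step 3: `ℓ ≥ 0` on violated configurations
  have hℓpos : ∀ c ∈ A, ∀ q ∈ Fc c, 0 ≤ ℓ q := by
    intro c hc q hq
    obtain ⟨⟨hx, hy, hz⟩, hxyz⟩ := hAmem c hc
    obtain ⟨⟨hi, hj, hk⟩, hLq⟩ := hFmem c q hq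
    have hmin := soloCW_min_le_log (hu _ hx _ hi) (hu _ hy _ hj) (hu _ hz _ hk) hxyz hLq
    have hθmin : θ ≤ min (u c.1 q.1) (min (u c.2.1 q.2.1) (u c.2.2 q.2.2)) :=
      le_min (hθ _ hx _ hi) (le_min (hθ _ hy _ hj) (hθ _ hz _ hk))
    show 0 ≤ Real.log (1 / ‖L q‖)
    linarith
  -- Step 4: the three slot sums
  have hclass : ∀ (π : Fin D × Fin D × Fin D → Fin D)
      (G : ℕ × ℕ × ℕ → Finset (Fin D × Fin D × Fin D)), (∀ c, G c ⊆ Fc c) →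
      (∀ e : ℕ, 1 ≤ e → ∀ T : Finset (Fin D × Fin D × Fin D), (∀ q ∈ T, L q ≠ 0) →
        (∀ q ∈ T, e ≤ rootMultiplicity (ρ (π q)) (Q.map (Int.castRingHom ℂ))) →
        (e : ℝ) * ∑ q ∈ T, ℓ q ≤ B) →
      ∑ c ∈ A, ∑ q ∈ G c, (m (π q) : ℝ) * ℓ q ≤ 2 * (Nat.log 2 Q.natDegree + 1) * B := by
    intro π G hG hcl
    refine soloMB_slot_sum_le m hm1 hmN π ℓ A G (hdisj.mono hG)
      (fun c hc q hq => hℓpos c hc q (hG c hq)) ?_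
    intro e he T hT1 hT2
    refine hcl e he T (fun q hq => ?_) (fun q hq => ?_)
    · obtain ⟨c, -, hqc⟩ := hT1 q hq
      exact (hFmem c q (hG c hqc)).2
    · rw [← hm]
      exact hT2 q hq
  have hS₁ := hclass (fun q => q.1) (fun c => (Fc c).filter (P₁ c))
    (fun c => Finset.filter_subset _ _)
    (fun e he T hT1 hT2 => soloMK_class_budget_fst Q F hQ hF ρ hρ hρF he T hT1 hT2)
  have hS₂ := hclass (fun q => q.2.1) (fun c => (Fc c).filter (P₂ c))
    (fun c => Finset.filter_subset _ _)
    (fun e he T hT1 hT2 => soloMK_class_budget_mid Q F hQ hF ρ hρ hρF he T hT1 hT2)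
  have hS₃ := hclass (fun q => q.2.2) (fun c => (Fc c).filter (P₃ c))
    (fun c => Finset.filter_subset _ _)
    (fun e he T hT1 hT2 => soloMK_class_budget_snd Q F hQ hF ρ hρ hρF he T hT1 hT2)
  -- Step 5: assemble
  have hsplit : ∀ c ∈ A, ∑ q ∈ Fc c, ((if P₁ c q then (m q.1 : ℝ) * ℓ q else 0)
      + (if P₂ c q then (m q.2.1 : ℝ) * ℓ q else 0)
      + (if P₃ c q then (m q.2.2 : ℝ) * ℓ q else 0)) =
      ∑ q ∈ (Fc c).filter (P₁ c), (m q.1 : ℝ) * ℓ q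
        + ∑ q ∈ (Fc c).filter (P₂ c), (m q.2.1 : ℝ) * ℓ q
        + ∑ q ∈ (Fc c).filter (P₃ c), (m q.2.2 : ℝ) * ℓ q := by
    intro c _
    have e₁ : ∑ q ∈ (Fc c).filter (P₁ c), (m q.1 : ℝ) * ℓ q =
        ∑ q ∈ Fc c, (if P₁ c q then (m q.1 : ℝ) * ℓ q else 0) := Finset.sum_filter _ _
    have e₂ : ∑ q ∈ (Fc c).filter (P₂ c), (m q.2.1 : ℝ) * ℓ q =
        ∑ q ∈ Fc c, (if P₂ c q then (m q.2.1 : ℝ) * ℓ q else 0) := Finset.sum_filter _ _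
    have e₃ : ∑ q ∈ (Fc c).filter (P₃ c), (m q.2.2 : ℝ) * ℓ q =
        ∑ q ∈ Fc c, (if P₃ c q then (m q.2.2 : ℝ) * ℓ q else 0) := Finset.sum_filter _ _
    rw [e₁, e₂, e₃, ← Finset.sum_add_distrib, ← Finset.sum_add_distrib]
  calc U' * ∑ c ∈ A, ∑ q ∈ Fc c,
          w c.1 q.1 / (∑ i ∈ Cl c.1, w c.1 i) * (w c.2.1 q.2.1 / ∑ i ∈ Cl c.2.1, w c.2.1 i)
            * (w c.2.2 q.2.2 / ∑ i ∈ Cl c.2.2, w c.2.2 i)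
      = ∑ c ∈ A, ∑ q ∈ Fc c, U' *
          (w c.1 q.1 / (∑ i ∈ Cl c.1, w c.1 i) * (w c.2.1 q.2.1 / ∑ i ∈ Cl c.2.1, w c.2.1 i)
            * (w c.2.2 q.2.2 / ∑ i ∈ Cl c.2.2, w c.2.2 i)) := by
        rw [Finset.mul_sum]
        exact Finset.sum_congr rfl (fun c _ => Finset.mul_sum _ _ _)
    _ ≤ ∑ c ∈ A, ∑ q ∈ Fc c, 2 * ((if P₁ c q then (m q.1 : ℝ) * ℓ q else 0)
          + (if P₂ c q then (m q.2.1 : ℝ) * ℓ q else 0)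
          + (if P₃ c q then (m q.2.2 : ℝ) * ℓ q else 0)) :=
        Finset.sum_le_sum (fun c hc => Finset.sum_le_sum (fun q hq => hterm c hc q hq))
    _ = 2 * (∑ c ∈ A, ∑ q ∈ (Fc c).filter (P₁ c), (m q.1 : ℝ) * ℓ q
          + ∑ c ∈ A, ∑ q ∈ (Fc c).filter (P₂ c), (m q.2.1 : ℝ) * ℓ q
          + ∑ c ∈ A, ∑ q ∈ (Fc c).filter (P₃ c), (m q.2.2 : ℝ) * ℓ q) := by
        rw [← Finset.sum_add_distrib, ← Finset.sum_add_distrib, Finset.mul_sum]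
        refine Finset.sum_congr rfl (fun c hc => ?_)
        rw [← Finset.mul_sum, hsplit c hc]
    _ ≤ 2 * (2 * (Nat.log 2 Q.natDegree + 1) * B + 2 * (Nat.log 2 Q.natDegree + 1) * B
          + 2 * (Nat.log 2 Q.natDegree + 1) * B) := by linarith
    _ = 12 * (Nat.log 2 Q.natDegree + 1) * B := by ring

end Budget

end Summit.Schanuel.Schanuel.Theorems
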